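import Summits.HubbardSuperconductivity.HubbardSuperconductivity.Theses.IntrinsicLargeN
import Summits.HubbardSuperconductivity.HubbardSuperconductivity.Theorems.TwTipContinuation.Negative.TipNormalForm
import Summits.HubbardSuperconductivity.HubbardSuperconductivity.Theorems.DeformationLadderPairingMonotonicity
import Literature.MathematicalPhysics.QuantumLattice.FinDimSpectrumSectorGibbsLimit

/-!
# Route `IntrinsicLargeN` — the glue items

Five bookkeeping items of route `IntrinsicLargeN` (sub-problem `HubbardSuperconductivity`):

* `UniformLROGivesSummitMatrix` (stmt-HubbardSuperconductivity-10968): the even-side `liminf`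
  bookkeeping, literally the tree's `summitMatrix_of_everyGSOrder`.
* `ShadowCondensation` (stmt-HubbardSuperconductivity-10972): the finite-`L` variational lemma — a
  unit sector state `φ` within `ε` of the ground energy of `K_g = H₀ − (g/L²)·D` inherits
  `(1-ε) L² c / g ≤ Re⟨φ, D φ⟩` from the sector gap `E_g + c ≤ E₀`
  (`Re⟨φ, K_g φ⟩ = Re⟨φ, H₀ φ⟩ − (g/L²) Re⟨φ, D φ⟩ ≥ E₀ − (g/L²) Re⟨φ, D φ⟩`).
* `LargeNThesisOfCruxes` (stmt-HubbardSuperconductivity-14241): cruxes ⇒ thesis, the deciding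
  theorem's chain run at every `U ∈ (0, min U₂ U₃)`.
* `SummitOfLargeNThesis` (stmt-HubbardSuperconductivity-14242): thesis ⇒ summit at `U := U₀/2`.
* `Assembly` (stmt-HubbardSuperconductivity-10969): the composition.

Sources: D. J. Scalapino, Phys. Rep. 250 (1995) 329, §2; H. Tasaki, *Physics and Mathematics of
Quantum Many-Body Systems* (2020) §2.2 (variational principle). No new definitions.
-/

-- the mandated namespace `Summit.<Summit>.<Problem>.Theorems` repeats `HubbardSuperconductivity`
-- (single-problem summit, D-0017), which the `dupNamespace` linter flags on every declaration
set_option linter.dupNamespace false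

namespace Summit.HubbardSuperconductivity.HubbardSuperconductivity.Theorems.IntrinsicLargeN

open Matrix Literature.MathematicalPhysics.QuantumLattice
open Summit.HubbardSuperconductivity.HubbardSuperconductivity.Theses.IntrinsicLargeN
open Summit.HubbardSuperconductivity.TwTipContinuation.Negative (summitMatrix_of_everyGSOrder)
open Summit.HubbardSuperconductivity.HubbardSuperconductivity.Theorems.DeformationLadder
  (re_rayleigh_deformed)

/-- **`UniformLROGivesSummitMatrix`** (stmt-HubbardSuperconductivity-10968): an eventual uniform
every-ground-state floor `a L⁴ ≤ Re⟨ψ, Δ_d†Δ_d ψ⟩` at `(U, δ)` gives the summit's matrix at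
`(U, δ)` — the even-side `liminf` bookkeeping `summitMatrix_of_everyGSOrder` (with its a-priori
cap keeping Mathlib's real `liminf` honest). Scalapino, Phys. Rep. 250 (1995) 329, §2. [folklore] -/
theorem uniformLROGivesSummitMatrix_proof :
    Summit.HubbardSuperconductivity.HubbardSuperconductivity.Theses.IntrinsicLargeN.UniformLROGivesSummitMatrix := by
  unfold UniformLROGivesSummitMatrix
  intro U δ h
  exact summitMatrix_of_everyGSOrder h

/-- **`ShadowCondensation`** (stmt-HubbardSuperconductivity-10972), the finite-`L` variational
lemma: for `g > 0`, a unit state `φ` of the sector `S = (N, S^z = 0)` with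
`Re⟨φ, K_g φ⟩ ≤ E_g + ε (E₀ − E_g)` (`K_g = H₀ − (g/L²) D`, `E_g`, `E₀` the sector energies of
`K_g`, `H₀ = hubbardTorus 2 L 1 0`, `ε ≤ 1`) and the sector gap `E_g + c ≤ E₀` has
`(1 − ε) L² c / g ≤ Re⟨φ, D φ⟩`: indeed `Re⟨φ, K_g φ⟩ = Re⟨φ, H₀ φ⟩ − (g/L²) Re⟨φ, D φ⟩` and
`E₀ ≤ Re⟨φ, H₀ φ⟩` (variational principle), so `(g/L²) Re⟨φ, D φ⟩ ≥ (1 − ε)(E₀ − E_g) ≥ (1 − ε) c`.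
Tasaki (2020) §2.2. [folklore] -/
theorem shadowCondensation_proof :
    Summit.HubbardSuperconductivity.HubbardSuperconductivity.Theses.IntrinsicLargeN.ShadowCondensation := by
  unfold ShadowCondensation
  intro g hg L _ N c ε φ hε hφ1 hφS hgap hnear
  have hL : (0 : ℝ) < (L : ℝ) := Nat.cast_pos.2 (Nat.pos_of_ne_zero (NeZero.ne L))
  have hL2 : (0 : ℝ) < (L : ℝ) ^ 2 := by positivity
  have hgL : 0 < g / (L : ℝ) ^ 2 := div_pos hg hL2
  -- the variational principle for `H₀` in the sector
  have hvar := minEnergyOn_le_rayleigh_of_mem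
    (hubbardTorus_isHermitian (hamiltonian_isHermitian_and_commute_holds _) 1 0)
    (szSector N 0) hφS hφ1
  -- split the Rayleigh value of `K_g`
  have hsplit := re_rayleigh_deformed L 0 g φ
  unfold expect at hnear ⊢
  rw [hsplit] at hnear
  set p := (star φ ⬝ᵥ ((pairField dWaveFormFactor L)ᴴ * pairField dWaveFormFactor L) *ᵥ φ).re
  set E₀ := (hubbardTorus 2 L 1 0).minEnergyOn (szSector N 0)
  set Eg := (hubbardTorus 2 L 1 0 - ((g / (L : ℝ) ^ 2 : ℝ) : ℂ) •
    ((pairField dWaveFormFactor L)ᴴ * pairField dWaveFormFactor L)).minEnergyOn (szSector N 0)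
  -- `(1 - ε) c ≤ (g/L²) p`
  have h1 : (1 - ε) * c ≤ g / (L : ℝ) ^ 2 * p := by nlinarith
  calc (1 - ε) * ((L : ℝ) ^ 2 * c / g)
      = ((1 - ε) * c) * ((L : ℝ) ^ 2 / g) := by ring
    _ ≤ (g / (L : ℝ) ^ 2 * p) * ((L : ℝ) ^ 2 / g) :=
        mul_le_mul_of_nonneg_right h1 (by positivity)
    _ = p := by field_simp

/-- **`LargeNThesisOfCruxes`** (stmt-HubbardSuperconductivity-14241): the Kohn–Luttinger point, the
reduced-BCS anchor, the pair-sector shadow, ground-eigenspace homogeneity and the variational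
shadow-condensation lemma give the thesis `LargeNThesis` with `U₀ := min U₂ U₃` and, at each
`U ∈ (0, U₀)`, `a := (1-θ')(1-θ)(1-ε) c/g` — the deciding theorem's chain run at every `U`.
Scalapino, Phys. Rep. 250 (1995) 329, §2. [folklore] -/
theorem largeNThesisOfCruxes_proof :
    Summit.HubbardSuperconductivity.HubbardSuperconductivity.Theses.IntrinsicLargeN.LargeNThesisOfCruxes := by
  unfold LargeNThesisOfCruxes
  intro hKL hA h1 h2 h3
  obtain ⟨δ, hδ, γ, U₁, hγ, hU₁, hdom⟩ := hKL
  have hδ1 : δ ∈ Set.Ioo (0:ℝ) 1 := ⟨hδ.1, by linarith [hδ.2]⟩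
  obtain ⟨κ, hκ, U₂, hU₂, hS⟩ := h1 δ hδ γ U₁ hγ hU₁ hdom
  obtain ⟨U₃, hU₃, hH⟩ := h2 δ hδ γ U₁ hγ hU₁ hdom
  have hm : 0 < min U₂ U₃ := lt_min hU₂ hU₃
  refine ⟨min U₂ U₃, hm, δ, hδ, fun U hU => ?_⟩
  have hUpos : 0 < U := hU.1
  have hU2 : U ∈ Set.Ioo (0:ℝ) U₂ := ⟨hUpos, lt_of_lt_of_le hU.2 (min_le_left _ _)⟩
  have hU3 : U ∈ Set.Ioo (0:ℝ) U₃ := ⟨hUpos, lt_of_lt_of_le hU.2 (min_le_right _ _)⟩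
  obtain ⟨g, hg, ε, θ, hε, hθ, L₁, hL₁⟩ := hS U hU2
  obtain ⟨θ', hθ', L₂, hL₂⟩ := hH U hU3
  have hκU : 0 < κ * U ^ 2 := by positivity
  have hgpos : 0 < g := lt_of_lt_of_le hκU hg
  obtain ⟨c, hc, L₃, hL₃⟩ := hA g hgpos δ hδ1
  have h1' : 0 < 1 - θ' := by linarith
  have h2' : 0 < 1 - θ := by linarith
  have h3' : 0 < 1 - ε := by linarith
  refine ⟨(1 - θ') * ((1 - θ) * ((1 - ε) * (c / g))), by positivity, max L₁ (max L₂ L₃), ?_⟩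
  intro L inst hL hEven ψ hψ hGS
  have hL1 : L₁ ≤ L := le_trans (le_max_left _ _) hL
  have hL2 : L₂ ≤ L := le_trans (le_trans (le_max_left _ _) (le_max_right _ _)) hL
  have hL3 : L₃ ≤ L := le_trans (le_trans (le_max_right _ _) (le_max_right _ _)) hL
  obtain ⟨ψ₀, hψ₀, hGS₀, φ, hφS, hφ1, hφE, hφLRO⟩ := hL₁ L hL1 hEven
  have hanchor := hL₃ L hL3 hEven
  have h3c := h3 g hgpos L (2 * ⌊(1 - δ) * (L : ℝ) ^ 2 / 2⌋₊) (c * (L : ℝ) ^ 2) ε φ hε.le hφ1 hφS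
    hanchor hφE
  have hhom := hL₂ L hL2 hEven ψ ψ₀ hψ hψ₀ hGS hGS₀
  calc (1 - θ') * ((1 - θ) * ((1 - ε) * (c / g))) * (L : ℝ) ^ 4
      = (1 - θ') * ((1 - θ) * ((1 - ε) * ((L : ℝ) ^ 2 * (c * (L : ℝ) ^ 2) / g))) := by ring
    _ ≤ (1 - θ') * ((1 - θ) * (expect ((pairField dWaveFormFactor L)ᴴ *
          pairField dWaveFormFactor L) φ).re) :=
        mul_le_mul_of_nonneg_left (mul_le_mul_of_nonneg_left h3c h2'.le) h1'.le
    _ ≤ (1 - θ') * (expect ((pairField dWaveFormFactor L)ᴴ * pairField dWaveFormFactor L) ψ₀).re :=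
        mul_le_mul_of_nonneg_left hφLRO h1'.le
    _ ≤ _ := hhom

/-- **`SummitOfLargeNThesis`** (stmt-HubbardSuperconductivity-14242): the thesis (an every-GS
floor at every `U ∈ (0, U₀)` at one doping `δ ∈ (0, 1/2)`) gives the summit at `(U₀/2, δ)` by the
even-side `liminf` bookkeeping `UniformLROGivesSummitMatrix`. Scalapino, Phys. Rep. 250 (1995)
329, §2 eq. (2.4). [folklore] -/
theorem summitOfLargeNThesis_proof :
    Summit.HubbardSuperconductivity.HubbardSuperconductivity.Theses.IntrinsicLargeN.SummitOfLargeNThesis := by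
  unfold SummitOfLargeNThesis LargeNThesis UniformLROGivesSummitMatrix
    _root_.HubbardSuperconductivity Literature.Hubbard.DWaveSuperconductivityHubbard
  rintro ⟨U₀, hU₀, δ, hδ, hX⟩ hG
  have hU : U₀ / 2 ∈ Set.Ioo (0 : ℝ) U₀ := ⟨by positivity, by linarith⟩
  exact ⟨U₀ / 2, hU.1, δ, hδ, hG (U₀ / 2) δ (hX (U₀ / 2) hU)⟩

/-- **Assembly of route `IntrinsicLargeN`** (stmt-HubbardSuperconductivity-10969):
`KohnLuttingerB1gPoint → ReducedBCSAnchor → PairSectorShadow → GroundEigenspaceHomogeneity →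
ShadowCondensation → UniformLROGivesSummitMatrix → HubbardSuperconductivity`, the composition
`summitOfLargeNThesis_proof (largeNThesisOfCruxes_proof …)`. Scalapino, Phys. Rep. 250 (1995)
329, §2. [folklore] -/
theorem intrinsicLargeN_assembly_proof :
    Summit.HubbardSuperconductivity.HubbardSuperconductivity.Theses.IntrinsicLargeN.Assembly := by
  unfold Assembly
  intro hKL hA h1 h2 h3 hG
  exact summitOfLargeNThesis_proof (largeNThesisOfCruxes_proof hKL hA h1 h2 h3) hG

end Summit.HubbardSuperconductivity.HubbardSuperconductivity.Theorems.IntrinsicLargeN
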